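import Mathlib.Analysis.Complex.Hadamard
import Mathlib.Analysis.Complex.Liouville
import Mathlib.Analysis.SpecialFunctions.Complex.LogBounds
import Mathlib.Analysis.SpecialFunctions.Trigonometric.DerivHyp
import Mathlib.Analysis.SpecialFunctions.Pow.Complex

/-!
# T⁴ programme, spine estimate NE9 — THE RATE AT THE APEX, ANALYTIC CURRENCY (MODEL half): three lines on the ellipse `l·cos(strip)` (Bernstein–Walsh ∕
# two-constants shape) + Cauchy's estimate ⇒ a function holomorphic and bounded by `M` near a real segment and `η`-small ON the segment has derivative
# `≤ e·η·log(M∕η)∕(l·Y)` at the centre — NO POLYNOMIAL LOSS — census item C45 (c) of cell `pub-balaban-gaps`, seat ne9 (gen 14)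

Cell `pub-balaban-gaps` (YM blitz G2, seat ne9, unit `pub-balaban-gaps-ne9-g14`; record `run/shared/lean/pub/pub-balaban-gaps/ne/NE9.md` §5 row C45).  Sequel to
`DirectPairingApexEffective` (C45 (a): convexity ⇒ the Wilson-loop expectations inherit exponent `1∕2` of the King route's generating-function rate, sharp in the
convex currency) and `DirectPairingApexSymmetric` (C45 (b): third cumulant ⇒ `2∕3`).  Those currencies use the generating functions on the REAL window only; node
U6's generating functions are restrictions of functions HOLOMORPHIC and uniformly bounded near the real axis (`log ∘ complexMGF` of an observable bounded by `1`),
and for such functions smallness on a real segment propagates into the complex neighbourhood with no polynomial loss.  This file is the MODEL half (pure complex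
analysis, Mathlib only); the junction with the tree's apex vocabulary is `DirectPairingApexAnalyticScheme`.  NO definition; nothing of Bałaban's asserted;
Mathlib's `Complex.HadamardThreeLines.norm_le_interp_of_mem_verticalClosedStrip₀₁'`, `Complex.norm_deriv_le_of_forall_mem_sphere_norm_le`,
`Complex.cpow_nat_inv_pow` consumed BY NAME.
* §1 `norm_le_interp_ellipse`: `D` holomorphic on an open set containing the filled ellipse `{l·cos z : ∣Im z∣ ≤ Y}`, `‖D‖ ≤ M` there, `‖D‖ ≤ η` on the segment
  `[−l, l] = {l·cos x}` ⇒ `‖D(l·cos z)‖ ≤ η^{1−∣Im z∣∕Y}·M^{∣Im z∣∕Y}` (three lines for `ζ ↦ D(l·cos(iYζ))` on `0 ≤ Re ζ ≤ 1`, whose edges go to the segment and to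
  the outer ellipse); `exists_cos_eq_of_norm_le_sinh`: the disc of radius `sinh y` is covered — `cos z = w` with `∣Im z∣ ≤ y` (`ζ = w + (w² − 1)^{1∕2}`,
  `z = −i·log ζ`, `e^{−y} ≤ ‖ζ‖ ≤ e^{y}`); `norm_le_interp_of_norm_le` (the bound on the disc `‖w‖ ≤ l·sinh y`); `norm_deriv_le_interp` (Cauchy:
  `‖D′(0)‖ ≤ η^{1−y∕Y}M^{y∕Y}∕(l·sinh y)`); `interp_at_log` ∕ `norm_deriv_le_log`: at `y = Y∕log(M∕η)` (admissible when `e·η ≤ M`) `‖D′(0)‖ ≤ e·η·log(M∕η)∕(l·Y)`.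
* §2 `limit_le_of_pairBound'`, `tendsto_of_pairBound'`: a pair bound `∣e (K+n) − e K∣ ≤ b_K → 0` for all `n` gives convergence and passes to the limit.

HONEST FRAMING: MODEL-level complex∕real analysis on hypothesis SHAPES (label MODEL) for rung (B)+1 bookkeeping on ONE FIXED finite four-torus; no statement about
Bałaban's d = 4 procedure is made here; NE9 NOT PRINTED ∕ NOT PROVED; spine PROVED 0∕9 unchanged; instance 0∕1; NOT UV stability, NOT the continuum limit, NOT
infinite volume, NOT a mass gap, NOT Clay.

References (TYPES only): the three-lines theorem and Cauchy's estimate are Mathlib theorems (proved there); the shape is the classical two-constants ∕ Bernstein–Walsh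
inequality for the segment (no locator asserted).
-/

namespace Summit.QuantumFields.BalabanUV.T4Continuum.NE9.DirectPairingApexAnalytic

open Complex Set Filter Topology Metric
open Complex.HadamardThreeLines (verticalStrip verticalClosedStrip)

/-! ## §1 Three lines on the ellipse, the covered disc, Cauchy's estimate -/

section Model

variable {D : ℂ → ℂ} {U : Set ℂ} {l Y M η : ℝ}

/-- Real and imaginary parts of the strip parametrisation `ζ ↦ iYζ`. [folklore] -/
theorem im_I_mul (Y : ℝ) (ζ : ℂ) : (I * Y * ζ).im = Y * ζ.re := by
  simp [mul_im, mul_re]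

/-- … and its real part. [folklore] -/
theorem re_I_mul (Y : ℝ) (ζ : ℂ) : (I * Y * ζ).re = -(Y * ζ.im) := by
  simp [mul_re, mul_im]

/-- **THREE LINES ON THE ELLIPSE** (Bernstein–Walsh shape).  `D` holomorphic on an open `U` containing the filled ellipse `{l·cos z : ∣Im z∣ ≤ Y}` (`Y > 0`),
`‖D‖ ≤ M` there and `‖D‖ ≤ η` on the segment `{l·cos x : x ∈ ℝ} = [−l, l]`: then `‖D(l·cos z)‖ ≤ η^{1−∣Im z∣∕Y}·M^{∣Im z∣∕Y}` for `∣Im z∣ ≤ Y` — Hadamard's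
three-lines theorem for `ζ ↦ D(l·cos(iYζ))` on `0 ≤ Re ζ ≤ 1`.  MODEL-level. [folklore] -/
theorem norm_le_interp_ellipse (hU : IsOpen U) (hD : DifferentiableOn ℂ D U) (hY : 0 < Y)
    (hmem : ∀ z : ℂ, |z.im| ≤ Y → (l : ℂ) * Complex.cos z ∈ U)
    (hM : ∀ z : ℂ, |z.im| ≤ Y → ‖D ((l : ℂ) * Complex.cos z)‖ ≤ M)
    (hη : ∀ x : ℝ, ‖D ((l : ℂ) * Complex.cos x)‖ ≤ η)
    {z : ℂ} (hz : |z.im| ≤ Y) :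
    ‖D ((l : ℂ) * Complex.cos z)‖ ≤ η ^ (1 - |z.im| / Y) * M ^ (|z.im| / Y) := by
  -- reduce to `0 ≤ z.im` by evenness of `cos`
  wlog hz0 : 0 ≤ z.im generalizing z
  · have hneg : 0 ≤ (-z).im := by rw [neg_im]; linarith [le_of_not_ge hz0]
    have hz' : |(-z).im| ≤ Y := by rwa [neg_im, abs_neg]
    have := this hz' hneg
    rwa [Complex.cos_neg, neg_im, abs_neg] at this
  rw [abs_of_nonneg hz0] at hz ⊢
  set F : ℂ → ℂ := fun ζ => D ((l : ℂ) * Complex.cos (I * Y * ζ)) with hF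
  have hdiffAt : ∀ ζ : ℂ, |ζ.re| ≤ 1 → DifferentiableAt ℂ F ζ := by
    intro ζ hζ
    have h1 : |(I * Y * ζ).im| ≤ Y := by
      rw [im_I_mul, abs_mul, abs_of_pos hY]
      nlinarith [abs_nonneg ζ.re]
    have hg : DifferentiableAt ℂ (fun ζ : ℂ => (l : ℂ) * Complex.cos (I * Y * ζ)) ζ := by fun_prop
    exact (hD.differentiableAt (hU.mem_nhds (hmem _ h1))).comp ζ hg
  have hd : DiffContOnCl ℂ F (verticalStrip 0 1) := by
    apply DifferentiableOn.diffContOnCl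
    intro ζ hζ
    have hsub : closure (verticalStrip 0 1) ⊆ verticalClosedStrip 0 1 := by
      have h := continuous_re.closure_preimage_subset (Ioo (0 : ℝ) 1)
      rw [closure_Ioo zero_ne_one] at h
      exact h
    have hζ' := hsub hζ
    simp only [verticalClosedStrip, mem_preimage, mem_Icc] at hζ'
    have : |ζ.re| ≤ 1 := by
      rw [abs_le]
      constructor <;> linarith [hζ'.1, hζ'.2]
    exact (hdiffAt ζ this).differentiableWithinAt
  have hB : BddAbove ((norm ∘ F) '' verticalClosedStrip 0 1) := by
    refine ⟨M, ?_⟩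
    rintro _ ⟨ζ, hζ, rfl⟩
    simp only [verticalClosedStrip, mem_preimage, mem_Icc] at hζ
    have h1 : |(I * Y * ζ).im| ≤ Y := by
      rw [im_I_mul, abs_of_nonneg (by nlinarith)]
      nlinarith
    exact hM _ h1
  have ha : ∀ ζ ∈ re ⁻¹' ({0} : Set ℝ), ‖F ζ‖ ≤ η := by
    intro ζ hζ
    simp only [mem_preimage, mem_singleton_iff] at hζ
    have e : I * Y * ζ = ((-(Y * ζ.im) : ℝ) : ℂ) := by
      apply Complex.ext
      · rw [re_I_mul]; simp
      · rw [im_I_mul, hζ]; simp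
    show ‖D ((l : ℂ) * Complex.cos (I * Y * ζ))‖ ≤ η
    rw [e]
    exact hη _
  have hb : ∀ ζ ∈ re ⁻¹' ({1} : Set ℝ), ‖F ζ‖ ≤ M := by
    intro ζ hζ
    simp only [mem_preimage, mem_singleton_iff] at hζ
    have h1 : |(I * Y * ζ).im| ≤ Y := by rw [im_I_mul, hζ, mul_one, abs_of_pos hY]
    exact hM _ h1
  -- the point `ζ₀` of the strip with `iYζ₀ = z`
  set ζ₀ : ℂ := ⟨z.im / Y, -(z.re / Y)⟩ with hζ₀
  have hζ₀z : I * Y * ζ₀ = z := by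
    apply Complex.ext
    · rw [re_I_mul]
      simp only [hζ₀]
      field_simp
    · rw [im_I_mul]
      simp only [hζ₀]
      field_simp
  have hζ₀mem : ζ₀ ∈ verticalClosedStrip 0 1 := by
    simp only [verticalClosedStrip, mem_preimage, mem_Icc]
    exact ⟨div_nonneg hz0 hY.le, (div_le_one hY).mpr hz⟩
  have key := Complex.HadamardThreeLines.norm_le_interp_of_mem_verticalClosedStrip₀₁' F hζ₀mem hd hB ha hb
  have hre0 : ζ₀.re = z.im / Y := rfl
  rw [hre0] at key
  have hFz : F ζ₀ = D ((l : ℂ) * Complex.cos z) := by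
    simp only [hF, hζ₀z]
  rwa [hFz] at key

/-- **THE DISC OF RADIUS `sinh y` IS COVERED BY THE ELLIPSE**: every `w` with `‖w‖ ≤ sinh y` is `cos z` for some `z` with `∣Im z∣ ≤ y`
(`ζ = w + (w² − 1)^{1∕2}` solves `ζ² − 2wζ + 1 = 0`, `e^{−y} ≤ ‖ζ‖ ≤ ‖w‖ + √(‖w‖² + 1) ≤ e^{y}`, `z = −i·log ζ`). [folklore] -/
theorem exists_cos_eq_of_norm_le_sinh {w : ℂ} {y : ℝ} (hw : ‖w‖ ≤ Real.sinh y) :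
    ∃ z : ℂ, Complex.cos z = w ∧ |z.im| ≤ y := by
  have hy : 0 ≤ y := by
    have := (norm_nonneg w).trans hw
    rwa [← Real.sinh_zero, Real.sinh_le_sinh] at this
  set s : ℂ := (w ^ 2 - 1) ^ ((2 : ℕ) : ℂ)⁻¹ with hs
  have hs2 : s ^ 2 = w ^ 2 - 1 := Complex.cpow_nat_inv_pow _ two_ne_zero
  set ζ : ℂ := w + s with hζ
  have hprod : ζ * (w - s) = 1 := by
    rw [hζ]
    linear_combination (-1 : ℂ) * hs2
  have hζne : ζ ≠ 0 := fun h => by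
    rw [h, zero_mul] at hprod
    exact zero_ne_one hprod
  -- norms: `‖s‖ ≤ cosh y`, so `‖w ± s‖ ≤ sinh y + cosh y = e^y`
  have hsn : ‖s‖ ≤ Real.cosh y := by
    have h1 : ‖s‖ ^ 2 ≤ Real.cosh y ^ 2 := by
      rw [← norm_pow, hs2, Real.cosh_sq]
      refine (norm_sub_le _ _).trans ?_
      rw [norm_pow, norm_one]
      nlinarith [norm_nonneg w, hw, Real.sinh_nonneg_iff.mpr hy]
    by_contra h
    have h' := lt_of_not_ge h
    nlinarith [norm_nonneg s, Real.cosh_pos y]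
  have hexp : Real.sinh y + Real.cosh y = Real.exp y := Real.sinh_add_cosh y
  have hζle : ‖ζ‖ ≤ Real.exp y := by
    rw [← hexp, hζ]
    exact (norm_add_le _ _).trans (add_le_add hw hsn)
  have hζ'le : ‖w - s‖ ≤ Real.exp y := by
    rw [← hexp]
    exact (norm_sub_le _ _).trans (add_le_add hw hsn)
  have hζge : Real.exp (-y) ≤ ‖ζ‖ := by
    have h1 : ‖ζ‖ * ‖w - s‖ = 1 := by rw [← norm_mul, hprod, norm_one]
    have hζpos : 0 < ‖ζ‖ := norm_pos_iff.mpr hζne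
    rw [Real.exp_neg, inv_le_comm₀ (Real.exp_pos y) hζpos]
    calc ‖ζ‖⁻¹ = ‖w - s‖ := by
          rw [eq_comm, ← mul_eq_one_iff_eq_inv₀ hζpos.ne']
          rw [mul_comm] at h1
          exact h1
      _ ≤ Real.exp y := hζ'le
  -- `z = −i log ζ`
  refine ⟨-(I * Complex.log ζ), ?_, ?_⟩
  · have hcos : 2 * Complex.cos (-(I * Complex.log ζ)) = 2 * w := by
      rw [Complex.two_cos]
      have e1 : -(I * Complex.log ζ) * I = Complex.log ζ := by
        rw [neg_mul, mul_assoc, mul_comm (Complex.log ζ) I, ← mul_assoc, I_mul_I]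
        ring
      have e2 : -(-(I * Complex.log ζ)) * I = -Complex.log ζ := by
        rw [neg_neg, mul_comm I, mul_assoc, I_mul_I]
        ring
      rw [e1, e2, Complex.exp_log hζne, Complex.exp_neg, Complex.exp_log hζne]
      -- `ζ + ζ⁻¹ = 2w` from `ζ² − 2wζ + 1 = 0`
      have hq : ζ ^ 2 + 1 = 2 * w * ζ := by
        rw [hζ]
        linear_combination hs2
      field_simp
      linear_combination hq
    exact mul_left_cancel₀ two_ne_zero hcos
  · have him : (-(I * Complex.log ζ)).im = -Real.log ‖ζ‖ := by
      rw [neg_im, mul_im, I_re, I_im, Complex.log_re]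
      ring
    rw [him, abs_neg, abs_le]
    have hζpos : 0 < ‖ζ‖ := norm_pos_iff.mpr hζne
    constructor
    · rw [neg_le, ← Real.log_le_iff_le_exp hζpos] at *
      have := (Real.le_log_iff_exp_le hζpos).mpr hζge
      linarith
    · exact (Real.log_le_iff_le_exp hζpos).mpr hζle

/-- Monotonicity of the interpolation bound `η^{1−t}·M^t = η·(M∕η)^t` in `t ∈ [0, 1]` for `0 ≤ η ≤ M`. [folklore] -/
theorem interp_mono {η M t t' : ℝ} (hη : 0 ≤ η) (hηM : η ≤ M) (htt : t' ≤ t) (ht1 : t ≤ 1) :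
    η ^ (1 - t') * M ^ t' ≤ η ^ (1 - t) * M ^ t := by
  have hM : 0 ≤ M := hη.trans hηM
  rcases hη.eq_or_lt with h0 | hpos
  · -- `η = 0`
    rw [← h0]
    rcases eq_or_lt_of_le (htt.trans ht1) with h1 | h1
    · have h2 : t = 1 := le_antisymm ht1 (h1 ▸ htt)
      rw [h1, h2]
    · rw [Real.zero_rpow (by linarith : (1 : ℝ) - t' ≠ 0), zero_mul]
      exact mul_nonneg (Real.rpow_nonneg le_rfl _) (Real.rpow_nonneg hM _)
  · have e : ∀ u : ℝ, η ^ (1 - u) * M ^ u = η * (M / η) ^ u := fun u => by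
      rw [Real.rpow_sub hpos, Real.rpow_one, Real.div_rpow hM hpos.le]
      field_simp
    rw [e, e]
    exact mul_le_mul_of_nonneg_left (Real.rpow_le_rpow_of_exponent_le ((one_le_div hpos).mpr hηM) htt) hpos.le

/-- **THE BOUND ON THE DISC.**  Under the hypotheses of `norm_le_interp_ellipse` and `0 ≤ η`: for `y ≤ Y` and `‖w‖ ≤ l·sinh y`,
`‖D w‖ ≤ η^{1−y∕Y}·M^{y∕Y}` (if `M < η` the right-hand side exceeds `M`). MODEL-level. [folklore] -/
theorem norm_le_interp_of_norm_le (hU : IsOpen U) (hD : DifferentiableOn ℂ D U) (hl : 0 < l) (hY : 0 < Y)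
    (hmem : ∀ z : ℂ, |z.im| ≤ Y → (l : ℂ) * Complex.cos z ∈ U)
    (hM : ∀ z : ℂ, |z.im| ≤ Y → ‖D ((l : ℂ) * Complex.cos z)‖ ≤ M)
    (hη : ∀ x : ℝ, ‖D ((l : ℂ) * Complex.cos x)‖ ≤ η) (hη0 : 0 ≤ η)
    {y : ℝ} (hy : y ≤ Y) {w : ℂ} (hw : ‖w‖ ≤ l * Real.sinh y) :
    ‖D w‖ ≤ η ^ (1 - y / Y) * M ^ (y / Y) := by
  have hw' : ‖w / l‖ ≤ Real.sinh y := by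
    rw [norm_div, Complex.norm_real, Real.norm_eq_abs, abs_of_pos hl, div_le_iff₀ hl]
    linarith
  obtain ⟨z, hz, hzy⟩ := exists_cos_eq_of_norm_le_sinh hw'
  have hzY : |z.im| ≤ Y := hzy.trans hy
  have e : (l : ℂ) * Complex.cos z = w := by
    rw [hz]
    field_simp [(Complex.ofReal_ne_zero.mpr hl.ne')]
  have hy0 : 0 ≤ y := (abs_nonneg _).trans hzy
  have hMnn : 0 ≤ M := (norm_nonneg _).trans (hM z hzY)
  rcases le_total η M with hηM | hMη
  · have h1 := norm_le_interp_ellipse hU hD hY hmem hM hη hzY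
    rw [e] at h1
    exact h1.trans (interp_mono hη0 hηM (div_le_div_of_nonneg_right hzy hY.le) ((div_le_one hY).mpr hy))
  · -- `M ≤ η`: the plain bound `M` already suffices
    have h1 := hM z hzY
    rw [e] at h1
    refine h1.trans ?_
    have ht1 : y / Y ≤ 1 := (div_le_one hY).mpr hy
    calc M = M ^ (1 - y / Y) * M ^ (y / Y) := by
          rw [← Real.rpow_add' hMnn (by ring_nf; norm_num), sub_add_cancel, Real.rpow_one]
      _ ≤ η ^ (1 - y / Y) * M ^ (y / Y) :=
          mul_le_mul_of_nonneg_right (Real.rpow_le_rpow hMnn hMη (by linarith)) (Real.rpow_nonneg hMnn _)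

/-- **CAUCHY's ESTIMATE ON THE COVERED DISC**: `‖D′(0)‖ ≤ η^{1−y∕Y}·M^{y∕Y}∕(l·sinh y)` for `0 < y ≤ Y`. MODEL-level. [folklore] -/
theorem norm_deriv_le_interp (hU : IsOpen U) (hD : DifferentiableOn ℂ D U) (hl : 0 < l) (hY : 0 < Y)
    (hmem : ∀ z : ℂ, |z.im| ≤ Y → (l : ℂ) * Complex.cos z ∈ U)
    (hM : ∀ z : ℂ, |z.im| ≤ Y → ‖D ((l : ℂ) * Complex.cos z)‖ ≤ M)
    (hη : ∀ x : ℝ, ‖D ((l : ℂ) * Complex.cos x)‖ ≤ η) (hη0 : 0 ≤ η)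
    {y : ℝ} (hy0 : 0 < y) (hy : y ≤ Y) :
    ‖deriv D 0‖ ≤ η ^ (1 - y / Y) * M ^ (y / Y) / (l * Real.sinh y) := by
  have hR : 0 < l * Real.sinh y := mul_pos hl (Real.sinh_pos_iff.mpr hy0)
  -- the closed disc of radius `l sinh y` lies in `U`
  have hsub : closedBall (0 : ℂ) (l * Real.sinh y) ⊆ U := by
    intro w hw
    rw [mem_closedBall, dist_zero_right] at hw
    have hw' : ‖w / l‖ ≤ Real.sinh y := by
      rw [norm_div, Complex.norm_real, Real.norm_eq_abs, abs_of_pos hl, div_le_iff₀ hl]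
      linarith
    obtain ⟨z, hz, hzy⟩ := exists_cos_eq_of_norm_le_sinh hw'
    have e : (l : ℂ) * Complex.cos z = w := by
      rw [hz]
      field_simp [(Complex.ofReal_ne_zero.mpr hl.ne')]
    rw [← e]
    exact hmem z (hzy.trans hy)
  have hdc : DiffContOnCl ℂ D (ball (0 : ℂ) (l * Real.sinh y)) := hD.diffContOnCl_ball hsub
  refine Complex.norm_deriv_le_of_forall_mem_sphere_norm_le hR hdc fun w hw => ?_
  rw [mem_sphere, dist_zero_right] at hw
  exact norm_le_interp_of_norm_le hU hD hl hY hmem hM hη hη0 hy hw.le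

/-- The arithmetic of the optimal level: for `0 < η`, `e·η ≤ M`, `0 < Y`, `0 < l`, at `y = Y∕log(M∕η)` one has `0 < y ≤ Y` and
`η^{1−y∕Y}·M^{y∕Y}∕(l·sinh y) ≤ e·η·log(M∕η)∕(l·Y)` (`η^{1−y∕Y}M^{y∕Y} = e·η`, `sinh y ≥ y`). [folklore] -/
theorem interp_at_log {η M Y l : ℝ} (hη0 : 0 < η) (hηM : Real.exp 1 * η ≤ M) (hY : 0 < Y) (hl : 0 < l) :
    0 < Y / Real.log (M / η) ∧ Y / Real.log (M / η) ≤ Y ∧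
      η ^ (1 - Y / Real.log (M / η) / Y) * M ^ (Y / Real.log (M / η) / Y) / (l * Real.sinh (Y / Real.log (M / η)))
        ≤ Real.exp 1 * η * Real.log (M / η) / (l * Y) := by
  set q : ℝ := M / η with hq
  have hqe : Real.exp 1 ≤ q := by rw [hq, le_div_iff₀ hη0]; exact hηM
  have hqpos : 0 < q := lt_of_lt_of_le (Real.exp_pos 1) hqe
  set L : ℝ := Real.log q with hLdef
  have hL : 1 ≤ L := by
    rw [hLdef, ← Real.log_exp 1]
    exact Real.log_le_log (Real.exp_pos 1) hqe
  have hLpos : 0 < L := lt_of_lt_of_le one_pos hL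
  set y : ℝ := Y / L with hy
  have hy0 : 0 < y := div_pos hY hLpos
  have hyY : y ≤ Y := div_le_self hY.le hL
  refine ⟨hy0, hyY, ?_⟩
  have hyY' : y / Y = 1 / L := by
    rw [hy]
    field_simp
  have hMq : M = η * q := by
    rw [hq]
    field_simp
  have hval : η ^ (1 - y / Y) * M ^ (y / Y) = Real.exp 1 * η := by
    rw [hyY', hMq, Real.mul_rpow hη0.le hqpos.le, ← mul_assoc, ← Real.rpow_add hη0, sub_add_cancel, Real.rpow_one,
      Real.rpow_def_of_pos hqpos, ← hLdef, mul_one_div_cancel hLpos.ne', mul_comm]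
  rw [hval]
  have hsinh : y ≤ Real.sinh y := Real.self_le_sinh_iff.mpr hy0.le
  calc Real.exp 1 * η / (l * Real.sinh y) ≤ Real.exp 1 * η / (l * y) :=
        div_le_div_of_nonneg_left (by positivity) (by positivity) (mul_le_mul_of_nonneg_left hsinh hl.le)
    _ = Real.exp 1 * η * L / (l * Y) := by
        rw [hy]
        field_simp

/-- **NO POLYNOMIAL LOSS**: at `y = Y∕log(M∕η)` (admissible when `e·η ≤ M`), `‖D′(0)‖ ≤ e·η·log(M∕η)∕(l·Y)`. MODEL-level. [folklore] -/
theorem norm_deriv_le_log (hU : IsOpen U) (hD : DifferentiableOn ℂ D U) (hl : 0 < l) (hY : 0 < Y)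
    (hmem : ∀ z : ℂ, |z.im| ≤ Y → (l : ℂ) * Complex.cos z ∈ U)
    (hM : ∀ z : ℂ, |z.im| ≤ Y → ‖D ((l : ℂ) * Complex.cos z)‖ ≤ M)
    (hη : ∀ x : ℝ, ‖D ((l : ℂ) * Complex.cos x)‖ ≤ η) (hη0 : 0 < η) (hηM : Real.exp 1 * η ≤ M) :
    ‖deriv D 0‖ ≤ Real.exp 1 * η * Real.log (M / η) / (l * Y) := by
  obtain ⟨hy0, hyY, hle⟩ := interp_at_log hη0 hηM hY hl
  exact (norm_deriv_le_interp hU hD hl hY hmem hM hη hη0.le hy0 hyY).trans hle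

end Model

/-! ## §2 Sequences: a pair bound that tends to zero -/

section Seq

variable {e b : ℕ → ℝ}

/-- A pair bound for ALL `n` passes to the limit: `∣e (K+n) − e K∣ ≤ c` for all `n` and `e → E` give `∣e K − E∣ ≤ c`. [folklore] -/
theorem limit_le_of_pairBound' {E c : ℝ} {K : ℕ} (hb : ∀ n, |e (K + n) - e K| ≤ c) (hE : Tendsto e atTop (𝓝 E)) :
    |e K - E| ≤ c := by
  have hE' : Tendsto (fun n => e (K + n)) atTop (𝓝 E) :=
    ((tendsto_add_atTop_iff_nat K).2 hE).congr fun n => by rw [add_comm]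
  have hlim : Tendsto (fun n => |e (K + n) - e K|) atTop (𝓝 |E - e K|) := (hE'.sub_const _).abs
  have := le_of_tendsto' hlim hb
  rwa [abs_sub_comm] at this

/-- `∣e (K+n) − e K∣ ≤ b_K` for all `n` with `b_K → 0` ⇒ `e` converges. [folklore] -/
theorem tendsto_of_pairBound' (hb : ∀ K n, |e (K + n) - e K| ≤ b K) (hb0 : Tendsto b atTop (𝓝 0)) :
    ∃ E : ℝ, Tendsto e atTop (𝓝 E) := by
  have hc : CauchySeq e := by
    refine Metric.cauchySeq_iff'.2 fun ε hε => ?_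
    obtain ⟨N, hN⟩ := eventually_atTop.1 (hb0.eventually (gt_mem_nhds hε))
    refine ⟨N, fun n hn => ?_⟩
    obtain ⟨k, rfl⟩ := Nat.exists_eq_add_of_le hn
    rw [Real.dist_eq]
    exact (hb N k).trans_lt (hN N le_rfl)
  exact cauchySeq_tendsto_of_complete hc

end Seq

end Summit.QuantumFields.BalabanUV.T4Continuum.NE9.DirectPairingApexAnalytic
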